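import Mathlib
import HarnessLib
import Summits.ABC.ABC.Theses.CongruentialReceptacle
import Summits.ABC.ABC.Theorems.CongruentialReceptacleReceptacleIdentityStableSzpiroDefs

/-!
# Crux `ReceptacleIdentity` (stmt-ABC-1813), line `stable-szpiro-duality`: the RATE LAW of matched families

Negative (boundary) lemma of the crux disprover (`refuter-cdisprove-stmt-ABC-1813-g2-0`, gen 2, 2026-08-17)
about the creative stub `stub_matchedFreeLunch` of the registered skeleton (vocabulary
`Summit.ABC.ABC.Theorems.StableSzpiro`, `Theorems/CongruentialReceptacleReceptacleIdentityStableSzpiroDefs.lean`).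

On the matched cone (`∂F ≥ 0`) the weighted log-radical is nonnegative,
`0 ≤ Σ_T w_T log rad(abc)_T` (`matched_sum_log_rad_nonneg`: it equals `Σ_d ∂F(d) · log p_d`), hence the
linear gain of a matched family is at most twice its weighted log-height,
`linGain ε F ≤ 2 Σ_T w_T log(abc)_T` (`matched_linGain_le`), and in particular at most
`2 log M · ‖F‖₁` when every triple of the support has `abc ≤ M` (`matched_linGain_le_height`).
Consequences (recorded in `Cruxes/ReceptacleIdentity/Disproof.lean` F7(i)): a matched free lunch of ratio `C`
(`C ‖F‖₁ < linGain`) needs `Σ_T w_T log(abc)_T > (C/2) ‖F‖₁` — positives must out-weigh negatives in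
log-height — and contains a triple with `abc > exp(C/2)` (`height_of_matchedFreeLunch_ratio`); the LP radius
`r*(X)` of the kit experiments is `O(log X)` by necessity, and templates are exponentially high in the
ratio they certify.  No statement of the route is asserted positively.
-/

-- `Summit.<Summit>.<Problem>` is the mandated summit-side namespace (CONVENTIONS §2); for the
-- single-conjunct summit `ABC` the two coincide, so the duplicate `ABC.ABC` is deliberate.
set_option linter.dupNamespace false

namespace Summit.ABC.ABC.Theorems.ReceptacleIdentity.Negative

open Literature.NumberTheory.DiophantineGeometry
open Summit.ABC.ABC.Theorems.StableSzpiro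
open Finset

variable {κ : ℝ}

/-- `log rad(abc) = Σ_{p ∣ abc} log p`. [folklore] -/
theorem log_rad_eq_sum_log (a b c : ℕ) :
    Real.log ((rad a b c : ℕ) : ℝ) = ∑ p ∈ (a * b * c).primeFactors, Real.log (p : ℝ) := by
  rw [rad_def, Nat.radical_eq_prod_primeFactors, Nat.cast_prod, Real.log_prod]
  intro p hp
  exact_mod_cast (Nat.prime_of_mem_primeFactors hp).ne_zero

/-- Pairing the boundary `∂T` of one triple with `log p` gives `Σ_{p ∣ abc} log p`. [folklore] -/
theorem boundary_sum_log (a b c : ℕ) :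
    ((boundary a b c).sum fun d m => m * Real.log (d.p : ℝ)) =
      ∑ p ∈ (a * b * c).primeFactors, Real.log (p : ℝ) := by
  unfold boundary
  rw [← Finsupp.sum_finsetSum_index (fun _ => by simp) (fun _ _ _ => by ring)]
  refine Finset.sum_congr rfl fun p _ => ?_
  rw [Finsupp.sum_single_index (by simp)]
  simp [datumAt]

/-- Pairing `∂F` with `log p` gives the weighted log-radical `Σ_T w_T log rad(abc)_T`. [folklore] -/
theorem bdry_sum_log (F : SignedFamily κ) :
    (F.bdry.sum fun d m => m * Real.log (d.p : ℝ)) =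
      ∑ T ∈ F.supp, F.w T * Real.log ((rad T.1 T.2.1 T.2.2 : ℕ) : ℝ) := by
  unfold SignedFamily.bdry
  rw [← Finsupp.sum_finsetSum_index (fun _ => by simp) (fun _ _ _ => by ring)]
  refine Finset.sum_congr rfl fun T _ => ?_
  rw [Finsupp.sum_smul_index' (fun _ => by simp), log_rad_eq_sum_log, ← boundary_sum_log,
    Finsupp.mul_sum]
  refine Finsupp.sum_congr fun d _ => ?_
  simp only [smul_eq_mul, mul_assoc]

/-- **On the matched cone the weighted log-radical is nonnegative**: `0 ≤ Σ_T w_T log rad(abc)_T`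
(it is `Σ_d ∂F(d) log p_d` with `∂F ≥ 0`). [folklore] -/
theorem matched_sum_log_rad_nonneg (F : SignedFamily κ) (hM : F.Matched) :
    0 ≤ ∑ T ∈ F.supp, F.w T * Real.log ((rad T.1 T.2.1 T.2.2 : ℕ) : ℝ) := by
  rw [← bdry_sum_log]
  unfold Finsupp.sum
  exact Finset.sum_nonneg fun d _ => mul_nonneg (hM d) (Real.log_natCast_nonneg _)

/-- **RATE LAW.** The linear gain of a matched family is at most twice its weighted log-height:
`Σ_T w_T s_T ≤ 2 Σ_T w_T log(abc)_T` (for `ε ≥ −6`, in particular for the crux's `ε > 0`). [folklore] -/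
theorem matched_linGain_le (F : SignedFamily κ) (hM : F.Matched) {ε : ℝ} (hε : 0 ≤ 6 + ε) :
    F.linGain ε ≤ 2 * ∑ T ∈ F.supp, F.w T * Real.log ((T.1 * T.2.1 * T.2.2 : ℕ) : ℝ) := by
  have h := matched_sum_log_rad_nonneg F hM
  have hsplit : F.linGain ε =
      2 * ∑ T ∈ F.supp, F.w T * Real.log ((T.1 * T.2.1 * T.2.2 : ℕ) : ℝ) -
        (6 + ε) * ∑ T ∈ F.supp, F.w T * Real.log ((rad T.1 T.2.1 T.2.2 : ℕ) : ℝ) := by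
    unfold SignedFamily.linGain szpiroExcess
    rw [Finset.mul_sum, Finset.mul_sum, ← Finset.sum_sub_distrib]
    refine Finset.sum_congr rfl fun T _ => ?_
    ring
  rw [hsplit]
  nlinarith [mul_nonneg hε h]

/-- **RATE LAW, height form.** If every triple of a matched family has `abc ≤ M`, then
`linGain ε F ≤ 2 log M · ‖F‖₁`. [folklore] -/
theorem matched_linGain_le_height (F : SignedFamily κ) (hM : F.Matched) {ε : ℝ} (hε : 0 ≤ 6 + ε)
    {M : ℝ} (hH : ∀ T ∈ F.supp, ((T.1 * T.2.1 * T.2.2 : ℕ) : ℝ) ≤ M) :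
    F.linGain ε ≤ 2 * Real.log M * F.l1 := by
  refine (matched_linGain_le F hM hε).trans ?_
  unfold SignedFamily.l1
  rw [mul_assoc, Finset.mul_sum (s := F.supp) (f := fun T => |F.w T|)]
  refine mul_le_mul_of_nonneg_left (Finset.sum_le_sum fun T hT => ?_) (by norm_num)
  obtain ⟨⟨ha, hb, hsum, -⟩, -, -⟩ := F.balanced T hT
  have hc : 0 < T.2.2 := by omega
  have habc1 : (1 : ℝ) ≤ ((T.1 * T.2.1 * T.2.2 : ℕ) : ℝ) := by
    have : 1 ≤ T.1 * T.2.1 * T.2.2 := Nat.one_le_iff_ne_zero.mpr (by positivity)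
    exact_mod_cast this
  have hlog0 : 0 ≤ Real.log ((T.1 * T.2.1 * T.2.2 : ℕ) : ℝ) := Real.log_nonneg habc1
  have hlogM : Real.log ((T.1 * T.2.1 * T.2.2 : ℕ) : ℝ) ≤ Real.log M :=
    Real.log_le_log (by linarith) (hH T hT)
  calc F.w T * Real.log ((T.1 * T.2.1 * T.2.2 : ℕ) : ℝ)
      ≤ |F.w T| * Real.log ((T.1 * T.2.1 * T.2.2 : ℕ) : ℝ) :=
        mul_le_mul_of_nonneg_right (le_abs_self _) hlog0
    _ ≤ |F.w T| * Real.log M := mul_le_mul_of_nonneg_left hlogM (abs_nonneg _)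
    _ = Real.log M * |F.w T| := mul_comm _ _

/-- **Templates are exponentially high in the ratio they certify**: a matched family beating the ratio
`C` (`C ‖F‖₁ < linGain`, as in `MatchedFreeLunch`) contains a triple with `abc > exp(C/2)`. [folklore] -/
theorem height_of_matchedFreeLunch_ratio (F : SignedFamily κ) (hM : F.Matched) {ε C : ℝ}
    (hε : 0 ≤ 6 + ε) (hC : C * F.l1 < F.linGain ε) :
    ∃ T ∈ F.supp, Real.exp (C / 2) < ((T.1 * T.2.1 * T.2.2 : ℕ) : ℝ) := by
  by_contra hcon
  have hcon' : ∀ T ∈ F.supp, ((T.1 * T.2.1 * T.2.2 : ℕ) : ℝ) ≤ Real.exp (C / 2) :=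
    fun T hT => le_of_not_gt fun h => hcon ⟨T, hT, h⟩
  have hle := matched_linGain_le_height F hM hε hcon'
  rw [Real.log_exp] at hle
  have : 2 * (C / 2) * F.l1 = C * F.l1 := by ring
  linarith

end Summit.ABC.ABC.Theorems.ReceptacleIdentity.Negative
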